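import Mathlib.Algebra.Polynomial.Splits
import Mathlib.Data.ZMod.QuotientGroup
import Literature.NumberTheory.EllipticCurves.X1ElevenMordellWeil
import Literature.NumberTheory.EllipticCurves.CuspFormLValueSeries
import Literature.NumberTheory.EllipticCurves.BSDRootNumber
import Literature.NumberTheory.EllipticCurves.BSDRootNumberOddParityProofs
import Literature.NumberTheory.DiophantineGeometry.LocalReductionProofs
import Literature.NumberTheory.DiophantineGeometry.LocalReductionHasMultiplicativeReductionAtProofs
import Literature.NumberTheory.DiophantineGeometry.LocalReductionFiniteBadPlacesProofs
import Literature.NumberTheory.DiophantineGeometry.LocalReductionIsIntegralAtProofs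
import Literature.NumberTheory.DiophantineGeometry.LocalReductionIsSemistableAtProofs
import Literature.RingTheory.DiscreteValuationRing.AdicCompletionResidueField
import Literature.NumberTheory.EllipticCurves.RootNumberAtkinLehnerSemistableProofs
import Literature.NumberTheory.EllipticCurves.SzpiroLocalDataProofs
import Literature.NumberTheory.DiophantineGeometry.PastenValuationProductsProofs
import Literature.Barriers.BirchSwinnertonDyer.NumericalVanishing
import HarnessLib

/-!
# `X₁(11)` (`11A3 : y² + y = x³ − x²`): the Birch–Swinnerton-Dyer rank formula
# `ord_{s=1} L(E, s) = rank E(ℚ)` (`= 0`), kernel-checked modulo the Modularity Theorem alone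

Topic `Literature/NumberTheory/EllipticCurves` (companion of `Curve11aAnalyticRankZero` and of the
`X1Eleven*` series). The tree PROVES, unconditionally, Mazur's `5`-descent conclusion
`11A3(ℚ) = ⟨(0,0)⟩ ≅ ℤ/5` (`X1Eleven.zmultiples_T_eq_top`, Billing–Mahler 1940; Mazur 1977,
Ch. III §5 Cor. (5.3)), hence `rank 11A3(ℚ) = 0` with NO hypothesis. Here the analytic side is added:
for the place above `11` the reduction of `11A3` (`Δ = −11`, `c₄ = 16`) is split multiplicative — the
node-tangent quadratic `16T² − 38 ≡ 5(T − 1)(T + 1) (mod 11)` splits over `κ(O_v)` (`38 − 16 = 22 =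
2·11`) — so `−∏_v W_v = +1`, `w(11A3) = +1` given modularity, `N = 11`, and the uniform certificate of
`CuspFormLValueSeries` (`L(E,1) = 2∑(aₙ/n)e^{−2πn/√N} > 0` for `w = +1`, `N ≤ 25`) gives
`L(11A3, 1) ≠ 0` (Cremona, Appendix to Ch. II, Example 1: "`L(f,1) = 0.2538418608559…`";
`11A1` and `11A3` are isogenous, same `f`). Consequently

* `Curve11a3.bsdRankFormula_of_modularity (hmod) : curve11A3.BSDRankFormula` —
  **`ord_{s=1} L(X₁(11), s) = rank X₁(11)(ℚ)`**, both sides `0`, the left modulo the Modularity Theorem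
  (`exists_isNewformOf`), the right unconditionally; no Gross–Zagier–Kolyvagin input
  (tree glue `bsdRankFormula_of_finite_point_of_entireLFunction_one_ne_zero`).

## References
* [CremonaAlgorithms1997] J. E. Cremona, *Algorithms for Modular Elliptic Curves*, 2nd ed. (1997),
  Appendix to Ch. II, Example 1 (`N = 11`; held: `book:cremona1997-algorithms-modular-elliptic-curves-2nd-ed`,
  PDF pp. 42–43: "the eigenvalue `ε₁₁` of `W₁₁` is `−1`", "`L(f,1)/Ω(f) = 1/5`",
  "`L(f,1) = 0.2538418608559…`"), Table 1, `N = 11`, curve `A3` (`[0,−1,1,0,0]`, `r = 0`, `|T| = 5`).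
* [Mazur1977] B. Mazur, *Modular curves and the Eisenstein ideal*, Publ. Math. IHÉS 47 (1977),
  Ch. III §5 Cor. (5.3).
* [SilvermanAEC2009] J. H. Silverman, *The Arithmetic of Elliptic Curves*, 2nd ed. (2009), VII.5
  Prop. 5.1, C.16.
* [Rohrlich1993Compositio] D. Rohrlich, Compositio Math. 87 (1993), Prop. 2.
* [BirchSwinnertonDyer1965] B. J. Birch, H. P. F. Swinnerton-Dyer, *Notes on elliptic curves. II*,
  J. reine angew. Math. 218 (1965).

## Design notes
Theorems only; the curve is the tree's `X1Eleven.curve11A3` (not redeclared); places are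
`v : HeightOneSpectrum ℤ`, the place above `11` being characterised by `v(Δ) < 1`; same layout as
`Curve11aAnalyticRankZero` (the isogenous `11A1`).
-/

open IsDedekindDomain IsDedekindDomain.HeightOneSpectrum WeierstrassCurve Polynomial

namespace Literature.NumberTheory.EllipticCurves.Curve11a3

open Literature.NumberTheory.EllipticCurves.X1Eleven (curve11A3 curve11A3_Δ T)

/-! ## Invariants of the equation -/

/-- `c₄(11A3) = 16`. [cite: CremonaAlgorithms1997, Table 1 (curve 11A3)] -/
theorem curve11A3_c₄ : curve11A3.c₄ = 16 := by
  norm_num [WeierstrassCurve.c₄, WeierstrassCurve.b₂, WeierstrassCurve.b₄, X1Eleven.curve11A3]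

/-- `b₂(11A3) = −4`. [cite: CremonaAlgorithms1997, Table 1 (curve 11A3)] -/
theorem curve11A3_b₂ : curve11A3.b₂ = -4 := by norm_num [WeierstrassCurve.b₂, X1Eleven.curve11A3]

/-- `b₄(11A3) = 0`. [cite: CremonaAlgorithms1997, Table 1 (curve 11A3)] -/
theorem curve11A3_b₄ : curve11A3.b₄ = 0 := by norm_num [WeierstrassCurve.b₄, X1Eleven.curve11A3]

/-- `b₆(11A3) = 1`. [cite: CremonaAlgorithms1997, Table 1 (curve 11A3)] -/
theorem curve11A3_b₆ : curve11A3.b₆ = 1 := by norm_num [WeierstrassCurve.b₆, X1Eleven.curve11A3]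

/-- `11A3` is integral at every finite place of `ℤ`. [cite: SilvermanAEC2009, VIII.8 (PDF p. 211)] -/
theorem curve11A3_isIntegralAt (v : HeightOneSpectrum ℤ) : curve11A3.IsIntegralAt v := by
  rw [isIntegralAt_iff_valuation_le_one]
  simp only [X1Eleven.curve11A3]
  refine ⟨by simp, ?_, by simp, by simp, by simp⟩
  simp

/-! ## Local root numbers -/

/-- At a place `v` with `v(Δ) = 1` (`v ∤ 11`) the curve has good reduction, so `W_v = 1`.
[cite: Rohrlich1993Compositio, Prop. 2(i)] -/
theorem localRootNumberAt_of_valuation_Δ_eq_one (v : HeightOneSpectrum ℤ)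
    (h : v.valuation ℚ curve11A3.Δ = 1) : curve11A3.localRootNumberAt v = 1 :=
  WeierstrassCurve.localRootNumberAt_of_hasGoodReductionAt
    (hasGoodReductionAt_of_valuation_Δ_eq_one_holds v curve11A3 (curve11A3_isIntegralAt v) h)

/-- If `v(Δ) < 1` then `v` is the place above `11`: `11 ∈ v` (`Δ = −11`). [folklore] -/
private theorem mem_of_valuation_Δ_lt_one {v : HeightOneSpectrum ℤ}
    (h : v.valuation ℚ curve11A3.Δ < 1) : (11 : ℤ) ∈ v.asIdeal := by
  rw [curve11A3_Δ] at h
  have h' : v.valuation ℚ (algebraMap ℤ ℚ 11) < 1 := by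
    have : (-11 : ℚ) = -(algebraMap ℤ ℚ 11) := by simp
    rw [this, Valuation.map_neg] at h
    exact h
  exact (v.valuation_lt_one_iff_mem (11 : ℤ)).mp h'

/-- `16 ∉ v` when `11 ∈ v` (Bezout: `9·16 − 13·11 = 1`). [folklore] -/
private theorem not_mem_16 {v : HeightOneSpectrum ℤ} (h11 : (11 : ℤ) ∈ v.asIdeal) :
    (16 : ℤ) ∉ v.asIdeal := by
  intro h16
  have hone : (1 : ℤ) ∈ v.asIdeal := by
    have := v.asIdeal.add_mem (v.asIdeal.mul_mem_left (-13) h11)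
      (v.asIdeal.mul_mem_left 9 h16)
    convert this using 1
    norm_num
  exact v.isPrime.ne_top ((Ideal.eq_top_iff_one _).mpr hone)

/-- At the place above `11`, `c₄ = 16` is a `v`-unit. [cite: SilvermanAEC2009, VII.5 Prop. 5.1(b)] -/
theorem valuation_c₄_eq_one {v : HeightOneSpectrum ℤ} (h11 : (11 : ℤ) ∈ v.asIdeal) :
    v.valuation ℚ curve11A3.c₄ = 1 := by
  rw [curve11A3_c₄]
  by_contra h
  have h' : v.valuation ℚ (algebraMap ℤ ℚ 16) ≠ 1 := by simpa using h
  have hlt := lt_of_le_of_ne (v.valuation_le_one (16 : ℤ)) h'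
  exact not_mem_16 h11 ((v.valuation_lt_one_iff_mem (16 : ℤ)).mp hlt)

/-- At the place above `11` the reduction is multiplicative (`v(c₄) = 1`, `v(Δ) < 1`).
[cite: SilvermanAEC2009, VII.5 Prop. 5.1(b) (PDF p. 191)] -/
theorem hasMultiplicativeReductionAt_curve11A3 {v : HeightOneSpectrum ℤ}
    (h : v.valuation ℚ curve11A3.Δ < 1) : curve11A3.HasMultiplicativeReductionAt v :=
  hasMultiplicativeReductionAt_of_valuation_c₄_eq_one (curve11A3_isIntegralAt v)
    (valuation_c₄_eq_one (mem_of_valuation_Δ_lt_one h)) h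

/-- **Split multiplicative reduction of `X₁(11)` at 11.** For the place `v` above `11` the chosen
local minimal model of `11A3` has split multiplicative reduction: the node-tangent quadratic
`16 T² − 38` of the integral model factors as `16 (T − 1)(T + 1)` over `κ(O_v)` (`38 − 16 = 2·11`),
i.e. `a₁₁ = +1` (Cremona, Appendix to Ch. II, Example 1: "`a(11) = −ε₁₁ = +1`").
[cite: CremonaAlgorithms1997, Appendix to Ch. II, Example 1 (N = 11)] -/
theorem hasSplitMultiplicativeReductionAt_curve11A3 {v : HeightOneSpectrum ℤ}
    (h : v.valuation ℚ curve11A3.Δ < 1) : curve11A3.HasSplitMultiplicativeReductionAt v := by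
  have h11 := mem_of_valuation_Δ_lt_one h
  have hc₄ := valuation_c₄_eq_one h11
  have hW := curve11A3_isIntegralAt v
  set O := v.adicCompletionIntegers ℚ with hO
  set K := v.adicCompletion ℚ with hK
  set EK := curve11A3.baseChange K with hEK
  haveI hmin : EK.IsMinimal O :=
    isMinimalAt_of_lt_valuation_c₄ hW
      (by rw [hc₄, ← WithZero.exp_zero]; exact WithZero.exp_lt_exp.mpr (by norm_num))
  haveI : EK.IsElliptic := by rw [hEK, WeierstrassCurve.baseChange]; infer_instance
  obtain ⟨D, hD⟩ : ∃ D : VariableChange K, curve11A3.localMinimalModel v = D • EK := ⟨_, rfl⟩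
  have hm : EK.HasMultiplicativeReduction O :=
    (hasMultiplicativeReduction_iff_of_isMinimal_of_eq_smul O hD EK.isUnit_Δ.ne_zero).mp
      (hasMultiplicativeReductionAt_curve11A3 h)
  unfold WeierstrassCurve.HasSplitMultiplicativeReductionAt
  rw [hasSplitMultiplicativeReduction_iff_of_isMinimal_of_eq_smul O hD EK.isUnit_Δ.ne_zero,
    hasSplitMultiplicativeReduction_iff]
  refine ⟨hm, ?_⟩
  have inj := IsFractionRing.injective O K
  have hnat : ∀ n : ℕ, algebraMap O K (n : O) = (n : K) := fun n => map_natCast _ n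
  have hc4 : (EK.integralModel O).c₄ = ((16 : ℕ) : O) := inj <| by
    rw [integralModel_c₄_eq, hnat, hEK, WeierstrassCurve.baseChange, map_c₄, curve11A3_c₄]; norm_num
  have ha1 : (EK.integralModel O).a₁ = 0 := inj <| by
    rw [integralModel_a₁_eq, hEK, WeierstrassCurve.baseChange, map_a₁]; simp [X1Eleven.curve11A3]
  have ha2 : (EK.integralModel O).a₂ = -((1 : ℕ) : O) := inj <| by
    rw [integralModel_a₂_eq, map_neg, hnat, hEK, WeierstrassCurve.baseChange, map_a₂]
    simp [X1Eleven.curve11A3]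
  have hb2 : (EK.integralModel O).b₂ = -((4 : ℕ) : O) := inj <| by
    rw [integralModel_b₂_eq, map_neg, hnat, hEK, WeierstrassCurve.baseChange, map_b₂, curve11A3_b₂]
    norm_num
  have hb4 : (EK.integralModel O).b₄ = 0 := inj <| by
    rw [integralModel_b₄_eq, hEK, WeierstrassCurve.baseChange, map_b₄, curve11A3_b₄]; simp
  have hb6 : (EK.integralModel O).b₆ = ((1 : ℕ) : O) := inj <| by
    rw [integralModel_b₆_eq, hnat, hEK, WeierstrassCurve.baseChange, map_b₆, curve11A3_b₆]
    norm_num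
  rw [hc4, ha1, ha2, hb2, hb4, hb6]
  -- `11 = 0`, hence `22 = 0`, in the residue field `κ(O_v)`
  set F := IsLocalRing.ResidueField O with hF
  set φ : O →+* F := algebraMap O F with hφ
  have h11F : (11 : F) = 0 := by
    have hker : (11 : ℤ) ∈ RingHom.ker ((IsLocalRing.residue O).comp (algebraMap ℤ O)) := by
      rw [ker_residue_comp_algebraMap ℚ v]; exact h11
    have h := RingHom.mem_ker.mp hker
    rwa [RingHom.comp_apply, map_ofNat, map_ofNat] at h
  have h22 : (22 : F[X]) = 0 := by
    rw [show (22 : F[X]) = C (22 : F) from (map_ofNat C 22).symm,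
      show (22 : F) = 11 * 2 by norm_num, h11F, zero_mul, map_zero]
  have hsplit : (C (16 : F) * ((X - C 1) * (X + C 1))).Splits :=
    (Splits.C _).mul ((Splits.X_sub_C _).mul (Splits.X_add_C _))
  convert hsplit using 1
  simp only [Polynomial.map_sub, Polynomial.map_add, Polynomial.map_mul, Polynomial.map_pow,
    Polynomial.map_X, Polynomial.map_C]
  simp only [map_mul, map_sub, map_add, map_neg, map_ofNat, map_zero, map_one, Nat.cast_ofNat,
    Nat.cast_one]
  linear_combination (-1 : F[X]) * h22

/-- **`W_v(11A3) = −1` at the place above `11`** (split multiplicative reduction).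
[cite: Rohrlich1993Compositio, Prop. 2(ii)] -/
theorem localRootNumberAt_of_valuation_Δ_lt_one {v : HeightOneSpectrum ℤ}
    (h : v.valuation ℚ curve11A3.Δ < 1) : curve11A3.localRootNumberAt v = -1 :=
  localRootNumberAt_of_hasSplitMultiplicativeReductionAt (hasSplitMultiplicativeReductionAt_curve11A3 h)

/-- `v(Δ) < 1` holds exactly at the place above `11`. [folklore] -/
private theorem valuation_Δ_lt_one_iff (v : HeightOneSpectrum ℤ) :
    v.valuation ℚ curve11A3.Δ < 1 ↔
      v = (Rat.HeightOneSpectrum.primesEquiv (R := ℤ)).symm ⟨11, by norm_num⟩ := by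
  constructor
  · intro h
    have h11 := mem_of_valuation_Δ_lt_one h
    apply (Rat.HeightOneSpectrum.primesEquiv (R := ℤ)).injective
    rw [Equiv.apply_symm_apply]
    apply Subtype.ext
    have hgen := Literature.NumberTheory.EllipticCurves.Rat.natGenerator_primesEquiv_symm
      (Rat.HeightOneSpectrum.primesEquiv v)
    rw [Equiv.symm_apply_apply] at hgen
    have hdvd : (Rat.HeightOneSpectrum.natGenerator v : ℤ) ∣ 11 := by
      rw [← Literature.NumberTheory.EllipticCurves.Rat.valuation_intCast_lt_one_iff]
      exact (v.valuation_lt_one_iff_mem (11 : ℤ)).mpr h11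
    have hp : (Rat.HeightOneSpectrum.primesEquiv v : ℕ).Prime := (Rat.HeightOneSpectrum.primesEquiv v).2
    rw [← hgen] at hp ⊢
    have : Rat.HeightOneSpectrum.natGenerator v ∣ 11 := by exact_mod_cast hdvd
    exact (Nat.prime_dvd_prime_iff_eq hp (by norm_num)).mp this
  · rintro rfl
    rw [curve11A3_Δ, show (-11 : ℚ) = ((-11 : ℤ) : ℚ) by push_cast; ring,
      Literature.NumberTheory.EllipticCurves.Rat.valuation_intCast_lt_one_iff,
      Literature.NumberTheory.EllipticCurves.Rat.natGenerator_primesEquiv_symm]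
    norm_num

/-- **The algebraic root number of `11A3` is `+1`**: `−∏ᶠ_v W_v = −W₁₁ = +1`.
[cite: CremonaAlgorithms1997, Table 1 (curve 11A3)] -/
theorem algebraicRootNumber_curve11A3 : curve11A3.algebraicRootNumber = 1 := by
  set v₀ : HeightOneSpectrum ℤ := (Rat.HeightOneSpectrum.primesEquiv (R := ℤ)).symm ⟨11, by norm_num⟩
    with hv₀
  have h0 : curve11A3.localRootNumberAt v₀ = -1 :=
    localRootNumberAt_of_valuation_Δ_lt_one ((valuation_Δ_lt_one_iff v₀).mpr hv₀)
  have ha : ∀ v : HeightOneSpectrum ℤ, v ≠ v₀ → curve11A3.localRootNumberAt v = 1 := by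
    intro v hv
    refine localRootNumberAt_of_valuation_Δ_eq_one v ?_
    rcases (WeierstrassCurve.valuation_Δ_le_one_of_isIntegralAt (curve11A3_isIntegralAt v)).lt_or_eq
      with h | h
    · exact absurd ((valuation_Δ_lt_one_iff v).mp h) (by rwa [hv₀] at hv)
    · exact h
  rw [WeierstrassCurve.algebraicRootNumber, finprod_eq_single _ v₀ ha, h0]
  norm_num

/-! ## Semistability, the conductor `11`, and the analytic root number under modularity -/

/-- **11A3 is semistable**. [cite: SilvermanAEC2009, VII.5 Prop. 5.1 (PDF p. 191)] -/
theorem curve11A3_isSemistable : curve11A3.IsSemistable ℤ := by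
  intro v
  have hint := curve11A3_isIntegralAt v
  rcases (WeierstrassCurve.valuation_Δ_le_one_of_isIntegralAt hint).eq_or_lt with h | h
  · exact WeierstrassCurve.isSemistableAt_of_valuation_Δ_eq_one hint h
  · exact WeierstrassCurve.isSemistableAt_of_valuation_c₄_eq_one hint
      (valuation_c₄_eq_one (mem_of_valuation_Δ_lt_one h))

/-- No place of additive reduction. [cite: SilvermanAEC2009, VII.5 Prop. 5.1 (PDF p. 191)] -/
theorem curve11A3_not_hasAdditiveReductionAt (v : HeightOneSpectrum ℤ) :
    ¬ curve11A3.HasAdditiveReductionAt v :=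
  (WeierstrassCurve.isSemistableAt_iff_not_hasAdditiveReductionAt v curve11A3).mp
    (curve11A3_isSemistable v)

/-- The conductor of `11A3` is squarefree. [cite: Silverman1994, IV.10.2] -/
theorem squarefree_conductorNorm_curve11A3 : Squarefree (curve11A3.conductorNorm ℤ) :=
  curve11A3.isSemistable_iff_squarefree_conductorNorm.mp curve11A3_isSemistable

/-- **The (analytic) root number of `11A3` is `+1`, from modularity alone** (Cremona: "the
eigenvalue `ε₁₁` of `W₁₁` is `−1`", the sign being minus that eigenvalue).
[cite: CremonaAlgorithms1997, Appendix to Ch. II, Example 1 (N = 11)] -/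
theorem rootNumber_curve11A3
    (hmod : Literature.NumberTheory.EllipticCurves.ModularForms.exists_isNewformOf) :
    curve11A3.rootNumber = 1 := by
  rw [(curve11A3.rootNumber_eq_algebraicRootNumber_of_squarefree squarefree_conductorNorm_curve11A3
    hmod) (fun v h => (curve11A3_not_hasAdditiveReductionAt v h).elim), algebraicRootNumber_curve11A3]

/-- **The conductor of `11A3` is `11`**. [cite: CremonaAlgorithms1997, Table 1 (curve 11A3)] -/
theorem conductorNorm_curve11A3 : curve11A3.conductorNorm ℤ = 11 := by
  have h11 : Nat.Prime 11 := by norm_num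
  refine Nat.eq_of_factorization_eq (curve11A3.conductorNorm_pos_holds).ne' (by norm_num) fun p => ?_
  by_cases hp : p.Prime
  swap
  · rw [Nat.factorization_eq_zero_of_not_prime _ hp, Nat.factorization_eq_zero_of_not_prime _ hp]
  rw [show p = ((⟨p, hp⟩ : Nat.Primes) : ℕ) from rfl, factorization_conductorNorm_primesEquiv_symm,
    h11.factorization]
  set v := (Rat.HeightOneSpectrum.primesEquiv (R := ℤ)).symm ⟨p, hp⟩ with hv
  have hgen : Rat.HeightOneSpectrum.natGenerator v = p :=
    Literature.NumberTheory.EllipticCurves.Rat.natGenerator_primesEquiv_symm ⟨p, hp⟩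
  have hΔcast : curve11A3.Δ = ((-11 : ℤ) : ℚ) := by rw [curve11A3_Δ]; push_cast; ring
  by_cases hp11 : p = 11
  · have hΔ : v.valuation ℚ curve11A3.Δ < 1 := by
      rw [hΔcast, Literature.NumberTheory.EllipticCurves.Rat.valuation_intCast_lt_one_iff, hgen, hp11]
      norm_num
    rw [(conductorExponent_eq_one_iff_holds v curve11A3).mpr (hasMultiplicativeReductionAt_curve11A3 hΔ)]
    simp [hp11]
  · have hΔ : v.valuation ℚ curve11A3.Δ = 1 := by
      rw [hΔcast, Literature.NumberTheory.EllipticCurves.Rat.valuation_intCast_eq_one_iff, hgen]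
      intro hd
      have hd' : (p : ℤ) ∣ 11 := dvd_neg.mp hd
      have hd'' : p ∣ 11 := by exact_mod_cast hd'
      exact hp11 ((Nat.prime_dvd_prime_iff_eq hp h11).mp hd'')
    rw [(conductorExponent_eq_zero_iff_holds v curve11A3).mpr
      (hasGoodReductionAt_of_valuation_Δ_eq_one_holds v curve11A3 (curve11A3_isIntegralAt v) hΔ)]
    simp [Ne.symm hp11]

/-! ## `L(X₁(11), 1) ≠ 0`, analytic rank `0`, and the BSD rank formula -/

/-- `e^{−2π/√11} ≤ 29/100`. [folklore] -/
private theorem exp_neg_two_pi_div_sqrt_eleven_le :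
    Real.exp (-(2 * Real.pi / Real.sqrt ((11 : ℕ) : ℝ))) ≤ 29 / 100 := by
  have hpi := Real.pi_gt_d6
  have he := Real.exp_one_gt_d9
  have hs : Real.sqrt ((11 : ℕ) : ℝ) < 3.3167 := by
    rw [Nat.cast_ofNat, Real.sqrt_lt' (by norm_num)]; norm_num
  have hs0 : 0 < Real.sqrt ((11 : ℕ) : ℝ) := Real.sqrt_pos.mpr (by norm_num)
  set x := 2 * Real.pi / Real.sqrt ((11 : ℕ) : ℝ) with hxdef
  have hx : 1.894 ≤ x := by
    rw [hxdef, le_div_iff₀ hs0]; nlinarith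
  have hx1 := Real.add_one_le_exp (x - 1)
  have hexp : Real.exp x = Real.exp 1 * Real.exp (x - 1) := by
    rw [← Real.exp_add]; congr 1; ring
  rw [Real.exp_neg, inv_le_comm₀ (Real.exp_pos x) (by norm_num), hexp]
  nlinarith [Real.exp_pos (x - 1)]

/-- **`ord_{s=1} L(X₁(11), s) = 0` from the Modularity Theorem alone.**
[cite: CremonaAlgorithms1997, Appendix to Ch. II, Example 1 (N = 11) and Table 1 (curve 11A3)] -/
theorem analyticRank_eq_zero_of_modularity
    (hmod : Literature.NumberTheory.EllipticCurves.ModularForms.exists_isNewformOf) :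
    curve11A3.analyticRank = 0 :=
  analyticRank_eq_zero_of_rootNumber_eq_one_of_exp_le hmod curve11A3 (rootNumber_curve11A3 hmod)
    (by rw [conductorNorm_curve11A3]; exact exp_neg_two_pi_div_sqrt_eleven_le)

/-- **`L(X₁(11), 1) ≠ 0`** (given modularity; Cremona: "`L(f,1) = 0.2538418608559…`",
"`L(f,1)/Ω(f) = 1/5`"). [cite: CremonaAlgorithms1997, Appendix to Ch. II, Example 1 (N = 11)] -/
theorem entireLFunction_one_ne_zero_of_modularity
    (hmod : Literature.NumberTheory.EllipticCurves.ModularForms.exists_isNewformOf) :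
    curve11A3.entireLFunction 1 ≠ 0 :=
  entireLFunction_one_ne_zero_of_rootNumber_eq_one_of_exp_le hmod curve11A3
    (rootNumber_curve11A3 hmod) (by rw [conductorNorm_curve11A3]; exact exp_neg_two_pi_div_sqrt_eleven_le)

/-- **`X₁(11)(ℚ)` is finite** — unconditional: `11A3(ℚ) = ⟨T⟩` (`X1Eleven.zmultiples_T_eq_top`,
the tree's `5`-descent) with `5T = O`. [cite: Mazur1977, Ch. III §5 Cor. (5.3)] -/
theorem finite_point : Finite curve11A3.toAffine.Point := by
  have hfin : IsOfFinAddOrder T :=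
    isOfFinAddOrder_iff_nsmul_eq_zero.mpr ⟨5, by norm_num, X1Eleven.five_nsmul_T⟩
  have hset := hfin.finite_zmultiples
  rw [X1Eleven.zmultiples_T_eq_top, AddSubgroup.coe_top] at hset
  exact Set.finite_univ_iff.mp hset

/-- **`rank X₁(11)(ℚ) = 0`** — unconditional. [cite: Mazur1977, Ch. III §5 Cor. (5.3)] -/
theorem mordellWeilRank_eq_zero : curve11A3.mordellWeilRank = 0 :=
  mordellWeilRank_eq_zero_of_finite curve11A3 finite_point

/-- **The Birch–Swinnerton-Dyer rank formula for `X₁(11)`**: `ord_{s=1} L(E, s) = rank E(ℚ)` (both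
`0`) for `E = 11A3`, kernel-checked **modulo the Modularity Theorem alone** — the algebraic side is
the tree's unconditional `5`-descent, the analytic side the certificate `L(E,1) > 0`; no
Gross–Zagier–Kolyvagin input. [cite: BirchSwinnertonDyer1965] [cite: CremonaAlgorithms1997, Table 1 (curve 11A3)] -/
theorem bsdRankFormula_of_modularity
    (hmod : Literature.NumberTheory.EllipticCurves.ModularForms.exists_isNewformOf) :
    curve11A3.BSDRankFormula :=
  bsdRankFormula_of_finite_point_of_entireLFunction_one_ne_zero curve11A3 finite_point
    (entireLFunction_one_ne_zero_of_modularity hmod)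

end Literature.NumberTheory.EllipticCurves.Curve11a3
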